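import Literature.NumberTheory.Automorphic.UnboundedDenominators
import Literature.NumberTheory.Automorphic.WohlfahrtLevel

/-!
# The unbounded denominators theorem (Calegari–Dimitrov–Tang) — proved ingredients

Sibling proofs file of `Literature/NumberTheory/Automorphic/UnboundedDenominators.lean`, which
vendors Calegari–Dimitrov–Tang's Theorem 1 (the unbounded denominators conjecture) as the named fact
`CalegariDimitrovTang2025_unboundedDenominators` and already proves its non-positive-weight cases.
Here we prove, sorry-free and with no new definitions or named facts (D-0026), ingredients of the
printed proof of the positive-weight case (F. Calegari, V. Dimitrov, Y. Tang, *The unbounded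
denominators conjecture*, J. Amer. Math. Soc. 38 (2025), arXiv:2109.09040 — numbering below is that
of the arXiv version), bottom-up, starting with the group theory of its §4 ("Noncongruence forms").

## §4.1 Wohlfahrt level — Wohlfahrt's theorem

CDT Definition 17 (after Wohlfahrt): the *level* `L(G)` of a finite-index `G ≤ SL₂(ℤ)` is the least
common multiple of its cusp widths, the width of the cusp `M∞` (`M ∈ SL₂(ℤ)`) being the least
`m > 0` with `± M Uᵐ M⁻¹ ∈ G`, `U = T = [1 1; 0 1]`. The one external input about this notion
used in CDT §4 (last step of the proof of Lemma 30: "the smallest congruence subgroup of Wohlfahrt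
level `N` containing `E = {±I}` is precisely `⟨E, Γ(N)⟩` by [Wohlfahrt]") is

> **Wohlfahrt's theorem** (K. Wohlfahrt, Illinois J. Math. 8 (1964), Theorem 2, crediting
> R. Fricke): a congruence subgroup of (general) level `m` contains `Γ(m)`.

"Level divides `N`" means exactly that every conjugate `g Tᴺ g⁻¹` (`g ∈ SL₂(ℤ)`) lies in `±G`; we
render it by that hypothesis, for subgroups of `SL₂(ℤ)` (homogeneous form), in two versions:

* `Gamma_le_of_isCongruenceSubgroup_of_forall_conj_T_pow_mem`: if `Γ ≤ SL(2, ℤ)` is a congruence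
  subgroup and `g Tᴺ g⁻¹ ∈ Γ` for all `g`, then `Γ(N) ≤ Γ`;
* `Gamma_le_of_isCongruenceSubgroup_of_neg_one_mem`: the same when `-1 ∈ Γ` and each `g Tᴺ g⁻¹`
  lies in `Γ` up to sign (CDT's setting `E ⊂ G`).

Both follow from the purely group-theoretic

* `Gamma_le_normalClosure_T_pow_sup_Gamma`: `Γ(N) ≤ ⟪Tᴺ⟫ ⊔ Γ(N M)` for every `M ≠ 0`, where `⟪Tᴺ⟫`
  is the normal closure of `Tᴺ` in `SL(2, ℤ)`,

whose proof is Wohlfahrt's (loc. cit. p. 531): modulo `n = N M`, a matrix `[a b; c d] ≡ 1 (mod N)`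
is first modified by a power of `Tᴺ` so that `a` becomes prime to `n` (a prime-by-prime choice
replaces Wohlfahrt's appeal to Dirichlet's theorem), then `b` and `c` are cleared by elements of
`⟪Tᴺ⟫`, and the remaining diagonal matrix `diag(a, a⁻¹) (mod n)`, `a ≡ 1 (mod N)`, is the classical
word `w(a) w(1)⁻¹`, `w(u) = E₁₂(u) E₂₁(-u⁻¹) E₁₂(u)`, which lies in `⟪Tᴺ⟫` modulo `n`. We package
the three steps after the first into one explicit word in `S`, `T` (`coe_wohlfahrtWord`,
`wohlfahrtWord_mem` below) whose reduction modulo `n` is checked by `ring`/`linear_combination`.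

The later sections of the file record further ingredients in the order of the printed proof: the
§4.3 leveraging skeleton (Proposition 26), Lemmas 19 and 21 in hypothesis form, the Diophantine
principle of §1.2, and — with the Wohlfahrt level `wohlfahrtLevel` of
`Literature/NumberTheory/Automorphic/WohlfahrtLevel.lean` (CDT Definition 17) — Wohlfahrt's theorem
and Lemmas 18, 19, 21 in their printed level form (`Gamma_wohlfahrtLevel_le_of_isCongruenceSubgroup`,
`wohlfahrtLevel_inf_dvd`, `wohlfahrtLevel_normalCore`, `wohlfahrtLevel_conjGL_map_dvd`), and the
first paragraph of §4.3: `f(pτ)` is a modular form with integer coefficients on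
`A⁻¹ Γ A ∩ SL₂(ℤ)`, of level dividing `L(Γ) p` (`exists_modularForm_conjGL_of_forall_coeff_int`);
and the arithmetic of the proof of Proposition 3.0.1 = arXiv v1 Proposition 15 (displays
(3.3)–(3.5): `…dim_le_of_radius_of_mean`). The analytic ingredients of §§2, 6 live under
`Literature/Analysis/Complex/` (`LogDerivativeLemma`, `NevanlinnaMultiplier`,
`OmittedValuesGrowth`, `DecomposableCauchyBound`).

## References

* [CalegariDimitrovTang2025] F. Calegari, V. Dimitrov, Y. Tang, The unbounded denominators
  conjecture, J. Amer. Math. Soc. 38 (2025), 627–702; arXiv:2109.09040, §4.1 (Definition 17,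
  Lemmas 18–21) and the proof of Lemma 30.
* [Wohlfahrt1964] K. Wohlfahrt, An extension of F. Klein's level concept, Illinois J. Math. 8
  (1964), 529–535, Theorems 1–2.
-/

namespace Literature.NumberTheory.Automorphic

open scoped MatrixGroups
open Matrix Matrix.SpecialLinearGroup CongruenceSubgroup ModularGroup

/- Throughout, `⟪Tᴺ⟫` in the prose stands for `Subgroup.normalClosure {ModularGroup.T ^ N}`, the
normal closure of `Tᴺ` in `SL(2, ℤ)` (written out in full in the statements: no notation is
introduced). -/

/-! ### Arithmetic preliminaries -/

/-- An integer none of whose prime-to-`m` obstructions occur — no prime factor of `m` divides it —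
is coprime to `m`. [folklore] -/
private lemma isCoprime_natCast_of_forall_prime_dvd {x : ℤ} {m : ℕ}
    (h : ∀ p : ℕ, p.Prime → p ∣ m → ¬ (p : ℤ) ∣ x) : IsCoprime x (m : ℤ) := by
  rw [Int.isCoprime_iff_gcd_eq_one]
  change Nat.gcd x.natAbs ((m : ℤ).natAbs) = 1
  rw [Int.natAbs_natCast]
  exact Nat.Coprime.symm <|
    Nat.coprime_of_dvd fun p pp hpm hpx ↦ h p pp hpm (Int.natCast_dvd.mpr hpx)

/-- Wohlfahrt's first reduction step, prime by prime (replacing Dirichlet's theorem): if `a` and `e`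
are coprime integers and `m ≠ 0`, some `a + k e` is coprime to `m` (take for `k` the product of the
primes dividing `m` but not `a`); cf. the first step of the proof of Wohlfahrt's Theorem 2, which
uses Dirichlet's theorem instead. [folklore] -/
private lemma exists_add_mul_isCoprime_natCast {a e : ℤ} (hae : IsCoprime a e) (m : ℕ)
    (hm : m ≠ 0) : ∃ k : ℤ, IsCoprime (a + k * e) (m : ℤ) := by
  classical
  let ps : Finset ℕ := {p ∈ m.primeFactors | ¬ (p : ℤ) ∣ a}
  refine ⟨(ps.prod id : ℕ), isCoprime_natCast_of_forall_prime_dvd fun p pp hpm hpx ↦ ?_⟩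
  have hpZ : Prime (p : ℤ) := Nat.prime_iff_prime_int.mp pp
  by_cases hpa : (p : ℤ) ∣ a
  · have hke : (p : ℤ) ∣ ((ps.prod id : ℕ) : ℤ) * e := by
      have := dvd_sub hpx hpa
      rwa [add_sub_cancel_left] at this
    rcases hpZ.dvd_or_dvd hke with hk | he
    · obtain ⟨q, hq, hpq⟩ := (pp.prime.dvd_finsetProd_iff id).mp (Int.natCast_dvd_natCast.mp hk)
      rw [Finset.mem_filter, Nat.mem_primeFactors] at hq
      rw [id, Nat.prime_dvd_prime_iff_eq pp hq.1.1] at hpq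
      subst hpq
      exact hq.2 hpa
    · have hu := hae.isUnit_of_dvd' hpa he
      rw [Int.isUnit_iff_natAbs_eq, Int.natAbs_natCast] at hu
      exact pp.one_lt.ne' hu
  · have pps : p ∈ ps :=
      Finset.mem_filter.mpr ⟨Nat.mem_primeFactors.mpr ⟨pp, hpm, hm⟩, hpa⟩
    have hk : (p : ℤ) ∣ ((ps.prod id : ℕ) : ℤ) * e :=
      Dvd.dvd.mul_right (Int.natCast_dvd_natCast.mpr (Finset.dvd_prod_of_mem id pps)) e
    exact hpa (by simpa using (Int.dvd_add_left hk).mp (by simpa [add_comm] using hpx))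

/-! ### Words in `S` and `T` -/

/-- `S Tᵐ S⁻¹` is the lower elementary matrix `[1 0; -m 1]` (stated with the coercions already
distributed, the form in which it is used after `coe_mul`, `coe_T_zpow`). [folklore] -/
private lemma coe_S_mul_T_zpow_mul_coe_S_inv (m : ℤ) :
    (S : Matrix (Fin 2) (Fin 2) ℤ) * !![1, m; 0, 1] *
        ((S⁻¹ : SL(2, ℤ)) : Matrix (Fin 2) (Fin 2) ℤ) = !![1, 0; -m, 1] := by
  rw [S_inv, coe_neg, coe_S]
  ext i j
  fin_cases i <;> fin_cases j <;> simp

/-- The upper-left entry of `Tᵉ γ`. [folklore] -/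
private lemma T_zpow_mul_apply_zero_zero (e : ℤ) (γ : SL(2, ℤ)) :
    (T ^ e * γ) 0 0 = γ 0 0 + e * γ 1 0 := by
  simp [coe_mul, coe_T_zpow, Matrix.mul_apply, Fin.sum_univ_two]

/-- Powers `Tᵉ`, `N ∣ e`, lie in `⟪Tᴺ⟫`. [folklore] -/
private lemma T_zpow_mem_normalClosure (N : ℕ) {e : ℤ} (he : (N : ℤ) ∣ e) :
    T ^ e ∈ Subgroup.normalClosure ({ModularGroup.T ^ N} : Set SL(2, ℤ)) := by
  obtain ⟨k, rfl⟩ := he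
  rw [_root_.zpow_mul, zpow_natCast]
  exact Subgroup.zpow_mem _ (Subgroup.subset_normalClosure (Set.mem_singleton _)) k

/-- Their `S`-conjugates `S Tᵉ S⁻¹`, `N ∣ e`, lie in `⟪Tᴺ⟫`. [folklore] -/
private lemma S_mul_T_zpow_mul_S_inv_mem_normalClosure (N : ℕ) {e : ℤ} (he : (N : ℤ) ∣ e) :
    S * T ^ e * S⁻¹ ∈ Subgroup.normalClosure ({ModularGroup.T ^ N} : Set SL(2, ℤ)) :=
  Subgroup.normalClosure_normal.conj_mem _ (T_zpow_mem_normalClosure N he) S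

/-- `Tᴺ ∈ Γ(N)`. [folklore] -/
private lemma T_pow_mem_Gamma (N : ℕ) : T ^ N ∈ Gamma N := by
  have h := ModularGroup_T_pow_mem_Gamma N N dvd_rfl
  rwa [Int.natAbs_natCast, zpow_natCast] at h

/-- `⟪Tᴺ⟫ ≤ Γ(N)` (`Γ(N)` is normal and contains `Tᴺ`). [folklore] -/
private lemma normalClosure_T_pow_le_Gamma (N : ℕ) :
    Subgroup.normalClosure ({ModularGroup.T ^ N} : Set SL(2, ℤ)) ≤ Gamma N := by
  haveI := Gamma_normal N
  exact Subgroup.normalClosure_le_normal (Set.singleton_subset_iff.mpr (T_pow_mem_Gamma N))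

/-- `Γ(N M) ≤ Γ(M)`. [folklore] -/
private lemma Gamma_mul_le (N M : ℕ) : Gamma (N * M) ≤ Gamma M := by
  intro γ hγ
  have ψ : ZMod (N * M) →+* ZMod M := ZMod.castHom (dvd_mul_left M N) (ZMod M)
  obtain ⟨h1, h2, h3, h4⟩ := Gamma_mem.mp hγ
  refine Gamma_mem.mpr ⟨?_, ?_, ?_, ?_⟩
  · simpa using congrArg ψ h1
  · simpa using congrArg ψ h2
  · simpa using congrArg ψ h3
  · simpa using congrArg ψ h4

/-! ### Wohlfahrt's word and its reduction -/

/-- **Wohlfahrt's word.** For integers `a b c y` the element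
`E₂₁(c y) · T · (T^{a-1} · (E T^{a-1} E⁻¹) · S T^{y-1} S⁻¹) · T⁻¹ · T^{y b}` of `SL(2, ℤ)`
(`E = S Tʸ S⁻¹ = E₂₁(-y)`, `E₂₁(m) = S T⁻ᵐ S⁻¹`) has the displayed integer matrix; modulo any `n`
with `a y ≡ 1` and `a d - b c = 1` it is `≡ [a b; c d]` (this is checked in `mem_sup_of_det`).
[cite: Wohlfahrt1964, Theorem 2 (proof, p. 531)] -/
private lemma coe_wohlfahrtWord (a b c y : ℤ) :
    ((S * T ^ (-(c * y)) * S⁻¹ *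
        (T * (T ^ (a - 1) * (S * T ^ y * S⁻¹ * T ^ (a - 1) * (S * T ^ (-y) * S⁻¹)) *
          (S * T ^ (y - 1) * S⁻¹)) * T⁻¹) * T ^ (y * b) : SL(2, ℤ)) : Matrix (Fin 2) (Fin 2) ℤ) =
      !![a * (2 - a * y), a * (2 - a * y) * (y * b) + (a * y - 1);
         c * y * (a * (2 - a * y)) + (1 - a * y),
         (c * y * (a * (2 - a * y)) + (1 - a * y)) * (y * b) + c * y * (a * y - 1) + y] := by
  simp only [coe_mul, coe_T_zpow, coe_T, coe_T_inv]
  simp only [coe_S_mul_T_zpow_mul_coe_S_inv, Matrix.mul_fin_two]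
  congrm !![?_, ?_; ?_, ?_] <;> ring

/-- Wohlfahrt's word lies in `⟪Tᴺ⟫` as soon as `N ∣ a - 1`, `N ∣ b`, `N ∣ c`, `N ∣ y - 1`.
[cite: Wohlfahrt1964, Theorem 2 (proof, p. 531)] -/
private lemma wohlfahrtWord_mem (N : ℕ) {a b c y : ℤ} (ha : (N : ℤ) ∣ a - 1) (hb : (N : ℤ) ∣ b)
    (hc : (N : ℤ) ∣ c) (hy : (N : ℤ) ∣ y - 1) :
    (S * T ^ (-(c * y)) * S⁻¹ *
        (T * (T ^ (a - 1) * (S * T ^ y * S⁻¹ * T ^ (a - 1) * (S * T ^ (-y) * S⁻¹)) *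
          (S * T ^ (y - 1) * S⁻¹)) * T⁻¹) * T ^ (y * b) : SL(2, ℤ)) ∈
      Subgroup.normalClosure ({ModularGroup.T ^ N} : Set SL(2, ℤ)) := by
  have hN : (Subgroup.normalClosure ({ModularGroup.T ^ N} : Set SL(2, ℤ))).Normal :=
    Subgroup.normalClosure_normal
  have hinv : (S * T ^ (-y) * S⁻¹ : SL(2, ℤ)) = (S * T ^ y * S⁻¹)⁻¹ := by group
  refine mul_mem (mul_mem (S_mul_T_zpow_mul_S_inv_mem_normalClosure N ?_)
    (hN.conj_mem _ (mul_mem (mul_mem (T_zpow_mem_normalClosure N ha) ?_)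
      (S_mul_T_zpow_mul_S_inv_mem_normalClosure N hy)) T)) (T_zpow_mem_normalClosure N ?_)
  · exact (dvd_mul_of_dvd_left hc y).neg_right
  · rw [hinv]
    exact hN.conj_mem _ (T_zpow_mem_normalClosure N ha) _
  · exact dvd_mul_of_dvd_right hb y

/-- Two elements of `SL(2, ℤ)` with entrywise-congruent matrices modulo `n` differ by an element of
`Γ(n)`; hence if one lies in `⟪Tᴺ⟫` the other lies in `⟪Tᴺ⟫ ⊔ Γ(n)`. [folklore] -/
private lemma mem_sup_of_congr {N n : ℕ} {γ δ : SL(2, ℤ)}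
    (hδ : δ ∈ Subgroup.normalClosure ({ModularGroup.T ^ N} : Set SL(2, ℤ)))
    (h : ∀ i j, ((δ i j : ℤ) : ZMod n) = ((γ i j : ℤ) : ZMod n)) :
    γ ∈ Subgroup.normalClosure ({ModularGroup.T ^ N} : Set SL(2, ℤ)) ⊔ Gamma n := by
  have key : Matrix.SpecialLinearGroup.map (Int.castRingHom (ZMod n)) δ =
      Matrix.SpecialLinearGroup.map (Int.castRingHom (ZMod n)) γ := by
    ext i j
    simpa only [SL_reduction_mod_hom_val] using h i j
  have hmem : δ⁻¹ * γ ∈ Gamma n := by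
    rw [Gamma_mem', map_mul, map_inv, key, inv_mul_cancel]
  rw [← mul_inv_cancel_left δ γ]
  exact mul_mem (Subgroup.mem_sup_left hδ) (Subgroup.mem_sup_right hmem)

/-- **Wohlfahrt's reduction** (Theorem 2 of Wohlfahrt 1964, proof, after its first step): a matrix
`[a b; c d] ∈ Γ(N)` whose entry `a` is prime to `n = N M` lies in `⟪Tᴺ⟫ Γ(n)`.
[cite: Wohlfahrt1964, Theorem 2 (proof, p. 531)] -/
private lemma mem_sup_of_det {N M : ℕ} {a b c d : ℤ} (hdet : a * d - b * c = 1)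
    (ha : (N : ℤ) ∣ a - 1) (hb : (N : ℤ) ∣ b) (hc : (N : ℤ) ∣ c) {y v : ℤ}
    (hyv : y * a + v * ((N * M : ℕ) : ℤ) = 1) :
    (⟨!![a, b; c, d], by rwa [Matrix.det_fin_two_of]⟩ : SL(2, ℤ)) ∈
      Subgroup.normalClosure ({ModularGroup.T ^ N} : Set SL(2, ℤ)) ⊔ Gamma (N * M) := by
  have hy : (N : ℤ) ∣ y - 1 := by
    have e : y - 1 = -(y * (a - 1)) - v * ((N * M : ℕ) : ℤ) := by linear_combination hyv
    rw [e]
    refine dvd_sub (dvd_mul_of_dvd_right ha y).neg_right (dvd_mul_of_dvd_right ?_ v)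
    push_cast
    exact dvd_mul_right _ _
  refine mem_sup_of_congr (wohlfahrtWord_mem N ha hb hc hy) (fun i j ↦ ?_)
  rw [coe_wohlfahrtWord]
  have hya : (y : ZMod (N * M)) * a = 1 := by
    have e := congrArg (Int.cast : ℤ → ZMod (N * M)) hyv
    simp only [Int.cast_add, Int.cast_mul, Int.cast_one, Int.cast_natCast, ZMod.natCast_self,
      mul_zero, add_zero] at e
    exact e
  have hdet' : (a : ZMod (N * M)) * d - b * c = 1 := by
    exact_mod_cast congrArg (Int.cast : ℤ → ZMod (N * M)) hdet
  fin_cases i <;> fin_cases j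
  · simp only [of_apply, cons_val', cons_val_zero, cons_val_fin_one, empty_val', Fin.zero_eta]
    push_cast
    linear_combination (-(a : ZMod (N * M))) * hya
  · simp only [of_apply, cons_val', cons_val_zero, cons_val_one, cons_val_fin_one, empty_val',
      Fin.zero_eta, Fin.mk_one]
    push_cast
    linear_combination (1 - (b : ZMod (N * M)) * (a * y - 1)) * hya
  · simp only [of_apply, cons_val', cons_val_zero, cons_val_one, cons_val_fin_one, empty_val',
      Fin.zero_eta, Fin.mk_one]
    push_cast
    linear_combination (-(c : ZMod (N * M)) * (a * y - 1) - 1) * hya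
  · simp only [of_apply, cons_val', cons_val_one, cons_val_fin_one, empty_val', Fin.mk_one]
    push_cast
    linear_combination (-((y : ZMod (N * M)) * b) * (c * (a * y - 1) + 1) + c * y + d) * hya +
      (-(y : ZMod (N * M))) * hdet'

/-- Wohlfahrt's reduction for an abstract `γ ∈ Γ(N)` with upper-left entry prime to `N M`.
[cite: Wohlfahrt1964, Theorem 2 (proof, p. 531)] -/
private lemma mem_sup_of_isCoprime {N M : ℕ} (γ : SL(2, ℤ)) (hγ : γ ∈ Gamma N)
    (hcop : IsCoprime (γ 0 0) ((N * M : ℕ) : ℤ)) :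
    γ ∈ Subgroup.normalClosure ({ModularGroup.T ^ N} : Set SL(2, ℤ)) ⊔ Gamma (N * M) := by
  induction γ using Matrix.SpecialLinearGroup.fin_two_induction with | h a b c d hdet =>
  obtain ⟨h00, h01, h10, -⟩ := Gamma_mem.mp hγ
  simp only [of_apply, cons_val', cons_val_zero, cons_val_one, cons_val_fin_one,
    empty_val'] at h00 h01 h10 hcop
  have ha : (N : ℤ) ∣ a - 1 := by
    rw [← ZMod.intCast_zmod_eq_zero_iff_dvd, Int.cast_sub, Int.cast_one, h00, sub_self]
  have hb : (N : ℤ) ∣ b := (ZMod.intCast_zmod_eq_zero_iff_dvd _ _).mp h01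
  have hc : (N : ℤ) ∣ c := (ZMod.intCast_zmod_eq_zero_iff_dvd _ _).mp h10
  obtain ⟨y, v, hyv⟩ := hcop
  exact mem_sup_of_det hdet ha hb hc hyv

/-! ### The theorems -/

/-- **Wohlfahrt's theorem, normal-closure form.** For all `N` and `M ≠ 0`,
`Γ(N) ≤ ⟪Tᴺ⟫ ⊔ Γ(N M)` in `SL(2, ℤ)`, where `⟪Tᴺ⟫ = Subgroup.normalClosure {Tᴺ}`: every matrix
congruent to `1` modulo `N` is a product of conjugates of `T^{±N}` times a matrix congruent to `1`
modulo `N M`. This is the content of the proof of [cite: Wohlfahrt1964, Theorem 2] (p. 531; there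
via Dirichlet's theorem, here prime by prime), and the group-theoretic input behind
[cite: CalegariDimitrovTang2025, §4.1 Definition 17 and proof of Lemma 30]. -/
theorem Gamma_le_normalClosure_T_pow_sup_Gamma (N : ℕ) {M : ℕ} (hM : M ≠ 0) :
    Gamma N ≤ Subgroup.normalClosure {ModularGroup.T ^ N} ⊔ Gamma (N * M) := by
  rcases Nat.eq_zero_or_pos N with rfl | hN
  · rw [Gamma_zero_bot]
    exact bot_le
  intro γ hγ
  obtain ⟨h00, -, h10, -⟩ := Gamma_mem.mp hγ
  have ha : (N : ℤ) ∣ γ 0 0 - 1 := by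
    rw [← ZMod.intCast_zmod_eq_zero_iff_dvd, Int.cast_sub, Int.cast_one, h00, sub_self]
  -- Step 1 (Wohlfahrt): make the upper-left entry prime to `N M` by a power of `Tᴺ`.
  have hcop : IsCoprime (γ 0 0) ((N : ℤ) * γ 1 0) := by
    refine IsCoprime.mul_right ?_ (isCoprime_col γ 0)
    obtain ⟨a₁, ha₁⟩ := ha
    exact ⟨1, -a₁, by linear_combination ha₁⟩
  obtain ⟨k, hk⟩ := exists_add_mul_isCoprime_natCast hcop (N * M) (Nat.mul_ne_zero hN.ne' hM)
  have ht : T ^ (k * N) ∈ Subgroup.normalClosure ({ModularGroup.T ^ N} : Set SL(2, ℤ)) :=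
    T_zpow_mem_normalClosure N (dvd_mul_left _ _)
  have hγ₁ : T ^ (k * N) * γ ∈ Gamma N := mul_mem (normalClosure_T_pow_le_Gamma N ht) hγ
  have hcop₁ : IsCoprime ((T ^ (k * N) * γ) 0 0) ((N * M : ℕ) : ℤ) := by
    rw [T_zpow_mul_apply_zero_zero]
    convert hk using 1
    ring
  -- Steps 2–4: Wohlfahrt's word.
  have h₁ := mem_sup_of_isCoprime _ hγ₁ hcop₁
  rw [← inv_mul_cancel_left (T ^ (k * N)) γ]
  exact mul_mem (Subgroup.mem_sup_left (inv_mem ht)) h₁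

/-- **Wohlfahrt's theorem** [cite: Wohlfahrt1964, Theorem 2] ("if `Γ` is a congruence subgroup of
general level `m` then `Γ ⊇ Γ(m)`", crediting Fricke), homogeneous form: a congruence subgroup
`Γ ≤ SL(2, ℤ)` containing every conjugate `g Tᴺ g⁻¹`, `g ∈ SL(2, ℤ)` — i.e. all of whose cusp
widths divide `N` — contains `Γ(N)`. This is the result invoked in
[cite: CalegariDimitrovTang2025, proof of Lemma 30] ("the smallest congruence subgroup of Wohlfahrt
level `N` containing `E` is precisely `⟨E, Γ(N)⟩` by [Wohlfahrt]"; Wohlfahrt level: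
op. cit. Definition 17). -/
theorem Gamma_le_of_isCongruenceSubgroup_of_forall_conj_T_pow_mem {Γ : Subgroup SL(2, ℤ)}
    (hΓ : IsCongruenceSubgroup Γ) {N : ℕ}
    (hT : ∀ g : SL(2, ℤ), g * ModularGroup.T ^ N * g⁻¹ ∈ Γ) : Gamma N ≤ Γ := by
  obtain ⟨M, hM, hle⟩ := hΓ
  refine (Gamma_le_normalClosure_T_pow_sup_Gamma N hM).trans
    (sup_le ?_ ((Gamma_mul_le N M).trans hle))
  refine (Subgroup.closure_le Γ).mpr fun x hx ↦ ?_
  obtain ⟨t, ht, hconj⟩ := Group.mem_conjugatesOfSet_iff.mp hx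
  obtain ⟨g, rfl⟩ := isConj_iff.mp hconj
  rw [Set.mem_singleton_iff.mp ht]
  exact hT g

/-- **Wohlfahrt's theorem**, form with signs [cite: Wohlfahrt1964, Theorem 2],
[cite: CalegariDimitrovTang2025, §4.1 Definition 17 and proof of Lemma 30]: if `Γ ≤ SL(2, ℤ)` is a
congruence subgroup containing `-1` (CDT: `E ⊂ G`) all of whose cusp widths divide `N` — for every
`g ∈ SL(2, ℤ)`, `± g Tᴺ g⁻¹ ∈ Γ` for some sign — then `Γ(N) ≤ Γ`; in particular the smallest such
`Γ` is `⟨-1, Γ(N)⟩`. -/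
theorem Gamma_le_of_isCongruenceSubgroup_of_neg_one_mem {Γ : Subgroup SL(2, ℤ)}
    (hΓ : IsCongruenceSubgroup Γ) (hE : (-1 : SL(2, ℤ)) ∈ Γ) {N : ℕ}
    (hT : ∀ g : SL(2, ℤ), g * ModularGroup.T ^ N * g⁻¹ ∈ Γ ∨ -(g * ModularGroup.T ^ N * g⁻¹) ∈ Γ) :
    Gamma N ≤ Γ :=
  Gamma_le_of_isCongruenceSubgroup_of_forall_conj_T_pow_mem hΓ fun g ↦ (hT g).elim id fun h ↦ by
    have := mul_mem hE h
    rwa [neg_one_mul, neg_neg] at this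


/-! ### §4.2 — the leveraging argument (skeleton of CDT Proposition 26)

CDT §4.2 attaches to every even `N` the degree `[R_N : M_N] ≥ 1` of the field generated by
bounded-denominator modular functions of Wohlfahrt level dividing `N` over the function field of
`Y(N)`, and proves the unbounded denominators conjecture in the form "`R_N = M_N` for every `N`"
from exactly two inputs: the leveraging step, Theorem 25 — if `[R_N : M_N] > 1` then
`[R_{Np} : M_{Np}] ≥ 2 [R_N : M_N]` for every prime `p ∤ N` — and the dimension bound
`[R_N : M_N] ≤ 12 ζ(2) C log N` (display (4.2)
combined with the hypothesis `[R_N : M_2] ≤ C N³ log N` of Proposition 26, which is what §§5–6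
establish). The deduction (proof of Proposition 26) is elementary; we record it abstractly, for any
function `r` on a set `S` of levels stable under `N ↦ N p` (`p ∤ N` prime; in CDT, the even
integers), replacing the prime number theorem used there by Bertrand's postulate: the primes are
taken one in each interval `(2ⁱ N, 2ⁱ⁺¹ N]`, so that `k` of them multiply `N` by at most
`(2N)^{k²}`, while `r` doubles `k` times. -/

/-- Growth comparison used in the leveraging argument: `A (k² + 1) < 2^{k+1}` for some `k`.
[folklore] -/
private lemma exists_mul_sq_add_one_lt_two_pow (A : ℝ) :
    ∃ k : ℕ, A * ((k : ℝ) ^ 2 + 1) < 2 ^ (k + 1) := by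
  rcases le_or_gt A 0 with hA | hA
  · exact ⟨0, by norm_num; linarith⟩
  have h1 : ∀ᶠ k : ℕ in Filter.atTop, (k : ℝ) ^ 2 / 2 ^ k < A⁻¹ :=
    (tendsto_pow_const_div_const_pow_of_one_lt 2 one_lt_two).eventually
      (gt_mem_nhds (inv_pos.mpr hA))
  have h2 : ∀ᶠ k : ℕ in Filter.atTop, A < 2 ^ k :=
    (tendsto_pow_atTop_atTop_of_one_lt one_lt_two).eventually (Filter.eventually_gt_atTop A)
  obtain ⟨k, hk1, hk2⟩ := (h1.and h2).exists
  refine ⟨k, ?_⟩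
  have h2k : (0 : ℝ) < 2 ^ k := by positivity
  rw [div_lt_iff₀ h2k] at hk1
  have : A * (k : ℝ) ^ 2 < 2 ^ k := by
    calc A * (k : ℝ) ^ 2 < A * (A⁻¹ * 2 ^ k) := by gcongr
      _ = 2 ^ k := by field_simp
  rw [show (2 : ℝ) ^ (k + 1) = 2 ^ k + 2 ^ k by ring]
  linarith

/-- **Skeleton of the leveraging argument** [cite: CalegariDimitrovTang2025, Proposition 26 (proof)
and Theorem 25]. Let `S` be a set of positive integers stable under `N ↦ N p` for primes `p ∤ N`
(CDT: the even integers), and `r : ℕ → ℕ` (CDT: `r N = [R_N : M_N]`) such that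
(i) `r N ≤ C log N` on `S` (CDT display (4.2) with the hypothesis of Proposition 26) and
(ii) `r N > 1 ⇒ r (N p) ≥ 2 r N` for `N ∈ S` and primes `p ∤ N` (CDT Theorem 25).
Then `r N ≤ 1` on `S` (CDT: `R_N = M_N`, the unbounded denominators conjecture). The printed proof
multiplies `N` by all primes `< X` coprime to `N` and invokes the prime number theorem twice; here
one prime is taken in each `(2ⁱ N, 2ⁱ⁺¹ N]` (Bertrand's postulate, Mathlib
`Nat.exists_prime_lt_and_le_two_mul`), which gives `2^{k+1} ≤ r ≤ |C| (k² + 1) log (2N)` after `k`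
steps, absurd for large `k`. -/
theorem CalegariDimitrovTang2025_unboundedDenominators.le_one_of_log_bound_of_doubling
    {S : Set ℕ} (hS : ∀ N ∈ S, ∀ p : ℕ, p.Prime → ¬ p ∣ N → N * p ∈ S) (r : ℕ → ℕ) (C : ℝ)
    (hbound : ∀ N ∈ S, (r N : ℝ) ≤ C * Real.log N)
    (hdouble : ∀ N ∈ S, ∀ p : ℕ, p.Prime → ¬ p ∣ N → 1 < r N → 2 * r N ≤ r (N * p)) :
    ∀ N ∈ S, N ≠ 0 → r N ≤ 1 := by
  intro N₀ hN₀S hN₀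
  by_contra h
  push Not at h
  -- one Bertrand prime in each interval `(2ⁱ N₀, 2ⁱ⁺¹ N₀]`
  have hex : ∀ i : ℕ, ∃ q, Nat.Prime q ∧ 2 ^ i * N₀ < q ∧ q ≤ 2 * (2 ^ i * N₀) := fun i ↦
    Nat.exists_prime_lt_and_le_two_mul _ (mul_ne_zero (pow_ne_zero _ two_ne_zero) hN₀)
  choose q hq using hex
  have hq_lt : ∀ {i k : ℕ}, i < k → q i < q k := fun {i k} hik ↦ by
    calc q i ≤ 2 * (2 ^ i * N₀) := (hq i).2.2
      _ = 2 ^ (i + 1) * N₀ := by ring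
      _ ≤ 2 ^ k * N₀ := Nat.mul_le_mul_right _ (Nat.pow_le_pow_right two_pos hik)
      _ < q k := (hq k).2.1
  -- the levels `P k = N₀ q₀ ⋯ q_{k-1}`
  set P : ℕ → ℕ := fun k ↦ N₀ * ∏ i ∈ Finset.range k, q i with hP
  have hP_succ : ∀ k, P (k + 1) = P k * q k := fun k ↦ by
    simp only [hP, Finset.prod_range_succ, mul_assoc]
  have hP_pos : ∀ k, 0 < P k := fun k ↦ Nat.pos_of_ne_zero <| mul_ne_zero hN₀ <|
    Finset.prod_ne_zero_iff.mpr fun i _ ↦ (hq i).1.ne_zero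
  have hq_not_dvd : ∀ k, ¬ q k ∣ P k := by
    intro k hdvd
    rcases (Nat.Prime.dvd_mul (hq k).1).mp hdvd with h0 | hprod
    · have := Nat.le_of_dvd (Nat.pos_of_ne_zero hN₀) h0
      have : N₀ ≤ 2 ^ k * N₀ := Nat.le_mul_of_pos_left _ (pow_pos two_pos k)
      exact absurd (hq k).2.1 (by omega)
    · obtain ⟨i, hi, hqi⟩ := ((hq k).1.prime.dvd_finsetProd_iff q).mp hprod
      have heq : q k = q i := (Nat.prime_dvd_prime_iff_eq (hq k).1 (hq i).1).mp hqi
      exact absurd (hq_lt (Finset.mem_range.mp hi)) (by omega)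
  -- `P k ∈ S` and `r (P k) ≥ 2ᵏ r N₀` (CDT Theorem 25, `k` times)
  have hPS : ∀ k, P k ∈ S ∧ 2 ^ k * r N₀ ≤ r (P k) := by
    intro k
    induction k with
    | zero => simpa [hP] using hN₀S
    | succ k ih =>
      have h1 : 1 < r (P k) :=
        lt_of_lt_of_le (lt_of_lt_of_le h (Nat.le_mul_of_pos_left _ (pow_pos two_pos k))) ih.2
      refine ⟨hP_succ k ▸ hS _ ih.1 _ (hq k).1 (hq_not_dvd k), ?_⟩
      rw [hP_succ k, pow_succ]
      calc 2 ^ k * 2 * r N₀ = 2 * (2 ^ k * r N₀) := by ring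
        _ ≤ 2 * r (P k) := Nat.mul_le_mul_left 2 ih.2
        _ ≤ r (P k * q k) := hdouble _ ih.1 _ (hq k).1 (hq_not_dvd k) h1
  -- `P k ≤ (2 N₀)^(k² + 1)`
  have hP_le : ∀ k, P k ≤ (2 * N₀) ^ (k * k + 1) := by
    intro k
    have hqi : ∀ i ∈ Finset.range k, q i ≤ (2 * N₀) ^ k := by
      intro i hi
      have hik := Finset.mem_range.mp hi
      have hk : k ≠ 0 := by omega
      calc q i ≤ 2 * (2 ^ i * N₀) := (hq i).2.2
        _ = 2 ^ (i + 1) * N₀ := by ring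
        _ ≤ 2 ^ k * N₀ := Nat.mul_le_mul_right _ (Nat.pow_le_pow_right two_pos hik)
        _ ≤ 2 ^ k * N₀ ^ k := Nat.mul_le_mul_left _ (Nat.le_self_pow hk N₀)
        _ = (2 * N₀) ^ k := (mul_pow 2 N₀ k).symm
    calc P k = N₀ * ∏ i ∈ Finset.range k, q i := rfl
      _ ≤ N₀ * ∏ _i ∈ Finset.range k, (2 * N₀) ^ k :=
          Nat.mul_le_mul_left _ (Finset.prod_le_prod' hqi)
      _ = N₀ * (2 * N₀) ^ (k * k) := by
          rw [Finset.prod_const, Finset.card_range, ← pow_mul]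
      _ ≤ (2 * N₀) * (2 * N₀) ^ (k * k) :=
          Nat.mul_le_mul_right _ (Nat.le_mul_of_pos_left _ two_pos)
      _ = (2 * N₀) ^ (k * k + 1) := (pow_succ' _ _).symm
  -- the real-number comparison
  set A : ℝ := |C| * Real.log ((2 * N₀ : ℕ) : ℝ) with hA
  obtain ⟨k, hk⟩ := exists_mul_sq_add_one_lt_two_pow A
  have hlow : (2 : ℝ) ^ (k + 1) ≤ r (P k) := by
    have : 2 ^ (k + 1) ≤ r (P k) := by
      calc 2 ^ (k + 1) = 2 ^ k * 2 := pow_succ 2 k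
        _ ≤ 2 ^ k * r N₀ := Nat.mul_le_mul_left _ h
        _ ≤ r (P k) := (hPS k).2
    exact_mod_cast this
  have hup : (r (P k) : ℝ) ≤ A * ((k : ℝ) ^ 2 + 1) := by
    have hlogP : Real.log (P k) ≤ Real.log (((2 * N₀) ^ (k * k + 1) : ℕ) : ℝ) :=
      Real.log_le_log (by exact_mod_cast hP_pos k) (by exact_mod_cast hP_le k)
    calc (r (P k) : ℝ) ≤ C * Real.log (P k) := hbound _ (hPS k).1
      _ ≤ |C| * Real.log (P k) :=
          mul_le_mul_of_nonneg_right (le_abs_self C) (Real.log_natCast_nonneg _)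
      _ ≤ |C| * Real.log (((2 * N₀) ^ (k * k + 1) : ℕ) : ℝ) :=
          mul_le_mul_of_nonneg_left hlogP (abs_nonneg C)
      _ = A * ((k : ℝ) ^ 2 + 1) := by
          rw [hA, Nat.cast_pow, Real.log_pow]
          push_cast
          ring
  exact absurd (hlow.trans hup) (not_le.mpr hk)

/-! ### §4.1 — level under normal core and under conjugation by `diag(p, 1)` (CDT Lemmas 19, 21)

In the hypothesis form used above ("every conjugate of `Tᴺ` lies in `G`" for "the Wohlfahrt level of
`G` divides `N`"), CDT Lemma 19 (the normal core `N(G)` of `G` again has level `N`) is immediate,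
and CDT Lemma 21 — for `A = diag(p, 1)` and `H` of level `N`, the group `A⁻¹ H A ∩ SL₂(ℤ)` (Mathlib:
`CongruenceSubgroup.conjGL H A`) has level dividing `N p` — is the following matrix identity: for
`g = [a b; c d] ∈ SL₂(ℤ)`, `A (g T^{Np} g⁻¹) A⁻¹` equals `h Tᴺ h⁻¹` with `h = [pa *; c *]` when
`p ∤ c`, and `(h Tᴺ h⁻¹)^{p²}` with `h = [a *; c/p *]` when `p ∣ c` (CDT, proof of Lemma 21, treats
the two cases `p ∤ a`, `p ∣ a` of the transposed situation and computes the exact width, `n`, `n/p`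
or `np`; only divisibility is used later, in §4.3). -/

/-- The conjugate `g Tᵐ g⁻¹` as an integer matrix: `1 + m (a, c)ᵀ (−c, a)… = [1 − m a c, m a²;
−m c², 1 + m a c]`, `(a, c)` the first column of `g`. [folklore] -/
private lemma coe_conj_T_zpow (g : SL(2, ℤ)) (m : ℤ) :
    ((g * T ^ m * g⁻¹ : SL(2, ℤ)) : Matrix (Fin 2) (Fin 2) ℤ) =
      !![1 - m * (g 0 0 * g 1 0), m * g 0 0 ^ 2; -(m * g 1 0 ^ 2), 1 + m * (g 0 0 * g 1 0)] := by
  induction g using Matrix.SpecialLinearGroup.fin_two_induction with | h a b c d hdet =>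
  rw [coe_mul, coe_mul, coe_inv, coe_T_zpow]
  simp only [adjugate_fin_two_of, of_apply, cons_val', cons_val_zero, cons_val_one,
    cons_val_fin_one, empty_val', Matrix.mul_fin_two]
  congrm !![?_, ?_; ?_, ?_]
  · linear_combination hdet
  · ring
  · ring
  · linear_combination hdet

/-- The same for a natural exponent. [folklore] -/
private lemma coe_conj_T_pow (g : SL(2, ℤ)) (m : ℕ) :
    ((g * T ^ m * g⁻¹ : SL(2, ℤ)) : Matrix (Fin 2) (Fin 2) ℤ) =
      !![1 - m * (g 0 0 * g 1 0), m * g 0 0 ^ 2; -(m * g 1 0 ^ 2), 1 + m * (g 0 0 * g 1 0)] := by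
  rw [← zpow_natCast]
  exact coe_conj_T_zpow g m

/-- **CDT Lemma 19, hypothesis form** [cite: CalegariDimitrovTang2025, Lemma 19]: if every
conjugate of `Tᴺ` lies in `G`, the same holds for the normal core `N(G)` of `G` (the largest normal
subgroup of `SL(2, ℤ)` contained in `G`; Mathlib `Subgroup.normalCore`, of finite index when `G` is:
`Subgroup.finiteIndex_normalCore`). -/
theorem conj_T_pow_mem_normalCore_of_forall_conj_T_pow_mem {G : Subgroup SL(2, ℤ)} {N : ℕ}
    (hT : ∀ g : SL(2, ℤ), g * ModularGroup.T ^ N * g⁻¹ ∈ G) (g : SL(2, ℤ)) :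
    g * ModularGroup.T ^ N * g⁻¹ ∈ G.normalCore := by
  rw [Subgroup.normalCore]
  exact fun b ↦ by simpa only [mul_assoc, _root_.mul_inv_rev] using hT (b * g)

/-- The `GL₂(ℝ)` bookkeeping in CDT Lemma 21: for `A = diag(p, 1)`, `y = A x A⁻¹` as soon as the
entries satisfy `y₀₀ = x₀₀`, `y₀₁ = p x₀₁`, `p y₁₀ = x₁₀`, `y₁₁ = x₁₁`. [folklore] -/
private lemma toGL_map_eq_conj_of_apply_eq {y x : SL(2, ℤ)} {A : GL (Fin 2) ℝ} {p : ℕ}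
    (hA : (A : Matrix (Fin 2) (Fin 2) ℝ) = !![(p : ℝ), 0; 0, 1])
    (h00 : y 0 0 = x 0 0) (h01 : y 0 1 = p * x 0 1) (h10 : (p : ℤ) * y 1 0 = x 1 0)
    (h11 : y 1 1 = x 1 1) :
    toGL (Matrix.SpecialLinearGroup.map (Int.castRingHom ℝ) y) =
      A * toGL (Matrix.SpecialLinearGroup.map (Int.castRingHom ℝ) x) * A⁻¹ := by
  have r00 : ((y 0 0 : ℤ) : ℝ) = x 0 0 := by exact_mod_cast h00
  have r01 : ((y 0 1 : ℤ) : ℝ) = p * x 0 1 := by exact_mod_cast h01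
  have r10 : (p : ℝ) * y 1 0 = x 1 0 := by exact_mod_cast h10
  have r11 : ((y 1 1 : ℤ) : ℝ) = x 1 1 := by exact_mod_cast h11
  rw [eq_mul_inv_iff_mul_eq]
  apply Units.ext
  simp only [Units.val_mul, coe_GL_coe_matrix, map_apply_coe, RingHom.mapMatrix_apply, hA]
  ext i j
  fin_cases i <;> fin_cases j <;>
    simp only [Matrix.mul_apply, Fin.sum_univ_two, Matrix.map_apply, of_apply, cons_val',
      cons_val_zero, cons_val_one, cons_val_fin_one, empty_val', eq_intCast, Fin.zero_eta,
      Fin.mk_one, Fin.isValue]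
  · linear_combination (p : ℝ) * r00
  · linear_combination r01
  · linear_combination r10
  · linear_combination r11

/-- **CDT Lemma 21, hypothesis form** [cite: CalegariDimitrovTang2025, Lemma 21]: let `p` be a
prime, `A = diag(p, 1) ∈ GL₂(ℝ)` and `H ≤ SL(2, ℤ)` a subgroup containing every conjugate of `Tᴺ`
("Wohlfahrt level dividing `N`"). Then `A⁻¹ H A ∩ SL(2, ℤ)` — Mathlib's `conjGL H A`, the subgroup
of `x ∈ SL(2, ℤ)` with `A x A⁻¹ ∈ H` — contains every conjugate of `T^{N p}` ("has Wohlfahrt level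
dividing `N p`"). This is the group by which `f(pτ)` is invariant when `f` is invariant by `H`
(CDT §4.3 of the published version, which runs the leveraging argument with `f(pτ)`; arXiv v1
writes `f(τ/p)`). -/
theorem conj_T_pow_mul_mem_conjGL_of_forall_conj_T_pow_mem {H : Subgroup SL(2, ℤ)} {N p : ℕ}
    (hp : p.Prime) (hT : ∀ g : SL(2, ℤ), g * ModularGroup.T ^ N * g⁻¹ ∈ H)
    {A : GL (Fin 2) ℝ} (hA : (A : Matrix (Fin 2) (Fin 2) ℝ) = !![(p : ℝ), 0; 0, 1])
    (g : SL(2, ℤ)) : g * ModularGroup.T ^ (N * p) * g⁻¹ ∈ conjGL H A := by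
  rw [mem_conjGL]
  have hx := coe_conj_T_pow g (N * p)
  induction g using Matrix.SpecialLinearGroup.fin_two_induction with | h a b c d hdet =>
  simp only [of_apply, cons_val', cons_val_zero, cons_val_one, cons_val_fin_one,
    empty_val'] at hx
  have hac : IsCoprime a c := by
    have := isCoprime_col (⟨!![a, b; c, d], by rwa [Matrix.det_fin_two_of]⟩ : SL(2, ℤ)) 0
    simpa using this
  by_cases hpc : (p : ℤ) ∣ c
  · -- `p ∣ c`: `A (g T^{Np} g⁻¹) A⁻¹ = (h Tᴺ h⁻¹)^{p²}`, `h = [a, -v; c/p, u]`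
    obtain ⟨c', rfl⟩ := hpc
    obtain ⟨u, v, huv⟩ := hac.of_mul_right_right
    obtain ⟨h, hh⟩ : ∃ h : SL(2, ℤ), (h : Matrix (Fin 2) (Fin 2) ℤ) = !![a, -v; c', u] :=
      ⟨⟨_, by rw [Matrix.det_fin_two_of]; linear_combination huv⟩, rfl⟩
    have hy := coe_conj_T_pow h (N * p ^ 2)
    rw [hh] at hy
    simp only [of_apply, cons_val', cons_val_zero, cons_val_one, cons_val_fin_one,
      empty_val'] at hy
    have hmem : h * T ^ (N * p ^ 2) * h⁻¹ ∈ H := by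
      simpa only [conj_pow, ← pow_mul] using Subgroup.pow_mem H (hT h) (p ^ 2)
    refine ⟨h * T ^ (N * p ^ 2) * h⁻¹, hmem, toGL_map_eq_conj_of_apply_eq hA ?_ ?_ ?_ ?_⟩ <;>
      simp only [hy, hx, of_apply, cons_val', cons_val_zero, cons_val_one, cons_val_fin_one,
        empty_val'] <;> push_cast <;> ring
  · -- `p ∤ c`: `A (g T^{Np} g⁻¹) A⁻¹ = h Tᴺ h⁻¹`, `h = [pa, -v; c, u]`
    have hpc' : IsCoprime ((p : ℤ) * a) c :=
      ((Nat.prime_iff_prime_int.mp hp).coprime_iff_not_dvd.mpr hpc).mul_left hac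
    obtain ⟨u, v, huv⟩ := hpc'
    obtain ⟨h, hh⟩ : ∃ h : SL(2, ℤ), (h : Matrix (Fin 2) (Fin 2) ℤ) = !![(p : ℤ) * a, -v; c, u] :=
      ⟨⟨_, by rw [Matrix.det_fin_two_of]; linear_combination huv⟩, rfl⟩
    have hy := coe_conj_T_pow h N
    rw [hh] at hy
    simp only [of_apply, cons_val', cons_val_zero, cons_val_one, cons_val_fin_one,
      empty_val'] at hy
    refine ⟨h * T ^ N * h⁻¹, hT h, toGL_map_eq_conj_of_apply_eq hA ?_ ?_ ?_ ?_⟩ <;>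
      simp only [hy, hx, of_apply, cons_val', cons_val_zero, cons_val_one, cons_val_fin_one,
        empty_val'] <;> push_cast <;> ring

/-! ### §1.2.1 — the Diophantine principle (CDT Lemma 1.2.2 of the published numbering)

Numbering: the tree cites CDT in the arXiv v1 numbering (Theorem 1, Lemmas 18–30, Proposition 26,
Remarks 58–59); in the published version (= arXiv v4) these are Theorem 1.0.1, Lemmas 4.1.2, 4.1.3,
4.1.5 (for Lemmas 18, 19, 21), Theorem 4.3.2 and Proposition 4.3.3 (for Theorem 25 and
Proposition 26, now at levels `2N`), Lemma 4.4.1 (Serre–Berger, for Lemma 30, where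
[Wohlfahrt1964, Theorem 2] is invoked) and Remarks 6.3.1–6.3.2 (for Remarks 58–59); the v1
Lemma 29 does not survive in the published version (its §4.4–4.6 replace it by an amalgam /
Ihara-lemma argument).

"The most basic antecedent" of the arithmetic algebraization method driving the whole proof
(CDT §1.2.1) is the following easy lemma: an integral power series converging on a disc of radius
`R > 1` is a polynomial — its coefficients are integers ("Liouville lower bound": `0` or `≥ 1` in
size) tending to `0` ("Cauchy upper bound"). We record it (it is not used later in the proof, but it
is the principle that CDT's Theorem 2.0.1/2.0.2 quantify). -/

/-- **The Diophantine principle, real form** [cite: CalegariDimitrovTang2025, Lemma 1.2.2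
(published numbering; §1.2.1)]: if `∑ aₙ xⁿ`, `aₙ ∈ ℤ`, converges at some real `x > 1`, then
`aₙ = 0` for all large `n` (the terms `aₙ xⁿ` tend to `0`, and a non-zero integer has absolute
value `≥ 1`). -/
theorem CalegariDimitrovTang2025_unboundedDenominators.eventually_eq_zero_of_summable
    (a : ℕ → ℤ) {x : ℝ} (hx : 1 < x) (hs : Summable fun n ↦ (a n : ℝ) * x ^ n) :
    ∃ d : ℕ, ∀ n, d ≤ n → a n = 0 := by
  obtain ⟨d, hd⟩ := Metric.tendsto_atTop.mp hs.tendsto_atTop_zero 1 one_pos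
  refine ⟨d, fun n hn ↦ ?_⟩
  have h := hd n hn
  rw [dist_zero_right, Real.norm_eq_abs, abs_mul,
    abs_of_pos (pow_pos (zero_lt_one.trans hx) n)] at h
  by_contra hne
  have h1 : (1 : ℝ) ≤ |(a n : ℝ)| := by exact_mod_cast Int.one_le_abs hne
  have h2 : (1 : ℝ) ≤ x ^ n := one_le_pow₀ hx.le
  nlinarith

/-- **The Diophantine principle** [cite: CalegariDimitrovTang2025, Lemma 1.2.2 (published
numbering; §1.2.1)], as printed: a power series `f(x) = ∑ aₙ xⁿ ∈ ℤ⟦x⟧` which defines a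
holomorphic function on `D(0, R)` for some `R > 1` — here: which converges at every complex `z`
with `‖z‖ < R` — is a polynomial: `aₙ = 0` for all large `n`. -/
theorem CalegariDimitrovTang2025_unboundedDenominators.eventually_eq_zero_of_summable_on_disc
    (a : ℕ → ℤ) {R : ℝ} (hR : 1 < R)
    (h : ∀ z : ℂ, ‖z‖ < R → Summable fun n ↦ (a n : ℂ) * z ^ n) :
    ∃ d : ℕ, ∀ n, d ≤ n → a n = 0 := by
  set x : ℝ := (1 + R) / 2 with hxdef
  have hx1 : 1 < x := by rw [hxdef]; linarith
  have hxR : x < R := by rw [hxdef]; linarith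
  refine CalegariDimitrovTang2025_unboundedDenominators.eventually_eq_zero_of_summable a hx1 ?_
  have hsum :=
    h x (by rw [Complex.norm_real, Real.norm_eq_abs, abs_of_pos (zero_lt_one.trans hx1)]; exact hxR)
  rw [← Complex.summable_ofReal]
  simpa only [Complex.ofReal_mul, Complex.ofReal_pow, Complex.ofReal_intCast] using hsum

/-! ### §4.1 in the language of the Wohlfahrt level

With `cuspWidth` / `wohlfahrtLevel` (`Literature/NumberTheory/Automorphic/WohlfahrtLevel.lean`,
CDT Definition 4.1.1 = arXiv v1 Definition 17, sign-free) the hypothesis "every conjugate of `Tᴺ`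
lies in `Γ`" used above reads "`L(Γ) ∣ N`" (`wohlfahrtLevel_dvd_iff`), and the results of §4.1
take their printed form. -/

/-- **Wohlfahrt's theorem** [cite: Wohlfahrt1964, Theorem 2] verbatim ("If `Γ` is a congruence
subgroup of (general) level `m` then `Γ ⊇ Γ(m)`"), for the sign-free level: a congruence subgroup
`Γ ≤ SL(2, ℤ)` contains `Γ(L(Γ))`. For `Γ ∋ -1` this is the statement used in
[cite: CalegariDimitrovTang2025, proof of Lemma 4.4.1 (arXiv v1: Lemma 30)]. -/
theorem Gamma_wohlfahrtLevel_le_of_isCongruenceSubgroup {Γ : Subgroup SL(2, ℤ)}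
    (hΓ : IsCongruenceSubgroup Γ) : Gamma (wohlfahrtLevel Γ) ≤ Γ := by
  haveI := hΓ.finiteIndex
  exact Gamma_le_of_isCongruenceSubgroup_of_forall_conj_T_pow_mem hΓ
    (conj_T_pow_wohlfahrtLevel_mem Γ)

/-- A congruence subgroup whose Wohlfahrt level divides `N` contains `Γ(N)`.
[cite: Wohlfahrt1964, Theorem 2] -/
theorem Gamma_le_of_wohlfahrtLevel_dvd {Γ : Subgroup SL(2, ℤ)} (hΓ : IsCongruenceSubgroup Γ)
    {N : ℕ} (hN : wohlfahrtLevel Γ ∣ N) : Gamma N ≤ Γ := by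
  haveI := hΓ.finiteIndex
  exact Gamma_le_of_isCongruenceSubgroup_of_forall_conj_T_pow_mem hΓ
    ((wohlfahrtLevel_dvd_iff Γ N).mp hN)

/-- The principal congruence subgroup `Γ(N)`, `N ≠ 0`, has Wohlfahrt level exactly `N` (so that,
with `Gamma_le_of_wohlfahrtLevel_dvd`, `Γ(N)` is the smallest congruence subgroup of level dividing
`N` — CDT: "the smallest congruence subgroup of Wohlfahrt level `N` containing `E` is precisely
`⟨E, Γ(N)⟩`", here sign-free). [cite: CalegariDimitrovTang2025, proof of Lemma 4.4.1] -/
theorem wohlfahrtLevel_Gamma (N : ℕ) [NeZero N] : wohlfahrtLevel (Gamma N) = N := by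
  refine Nat.dvd_antisymm (wohlfahrtLevel_Gamma_dvd N) ?_
  have h := (Gamma_mem.mp (T_pow_wohlfahrtLevel_mem (Gamma N))).2.1
  rw [← zpow_natCast, ModularGroup.coe_T_zpow] at h
  simp only [of_apply, cons_val', cons_val_one, cons_val_fin_one, cons_val_zero, empty_val',
    Int.cast_natCast, ZMod.natCast_eq_zero_iff] at h
  exact h

/-- **CDT Lemma 4.1.2** (arXiv v1: Lemma 18), sign-free form: if the Wohlfahrt levels of `G` and
`H` divide `N`, so does the level of `G ∩ H` ("any cusp of `G ∩ H` also has cusp width dividing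
`N`"). [cite: CalegariDimitrovTang2025, Lemma 4.1.2] -/
theorem wohlfahrtLevel_inf_dvd {G H : Subgroup SL(2, ℤ)} [G.FiniteIndex] [H.FiniteIndex] {N : ℕ}
    (hG : wohlfahrtLevel G ∣ N) (hH : wohlfahrtLevel H ∣ N) : wohlfahrtLevel (G ⊓ H) ∣ N :=
  (wohlfahrtLevel_dvd_iff (G ⊓ H) N).mpr fun g ↦
    ⟨(wohlfahrtLevel_dvd_iff G N).mp hG g, (wohlfahrtLevel_dvd_iff H N).mp hH g⟩

/-- **CDT Lemma 4.1.3** (arXiv v1: Lemma 19), sign-free form: the normal core `N(G)` of a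
finite-index `G` (the largest normal subgroup of `SL(2, ℤ)` contained in `G`; of finite index,
Mathlib `Subgroup.finiteIndex_normalCore`) has the same Wohlfahrt level as `G`.
[cite: CalegariDimitrovTang2025, Lemma 4.1.3] -/
theorem wohlfahrtLevel_normalCore (G : Subgroup SL(2, ℤ)) [G.FiniteIndex] :
    wohlfahrtLevel G.normalCore = wohlfahrtLevel G :=
  Nat.dvd_antisymm
    ((wohlfahrtLevel_dvd_iff G.normalCore _).mpr
      (conj_T_pow_mem_normalCore_of_forall_conj_T_pow_mem (conj_T_pow_wohlfahrtLevel_mem G)))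
    (wohlfahrtLevel_dvd_of_le G.normalCore_le)

/-- **CDT Lemma 4.1.5** (arXiv v1: Lemma 21), common-period form: for `p` prime,
`A = diag(p, 1)` and `H` of finite index, every conjugate of `T^{L(H) p}` lies in
`A⁻¹ H A ∩ SL(2, ℤ) = conjGL H A`. [cite: CalegariDimitrovTang2025, Lemma 4.1.5] -/
theorem conj_T_pow_wohlfahrtLevel_mul_mem_conjGL {H : Subgroup SL(2, ℤ)} [H.FiniteIndex] {p : ℕ}
    (hp : p.Prime) {A : GL (Fin 2) ℝ} (hA : (A : Matrix (Fin 2) (Fin 2) ℝ) = !![(p : ℝ), 0; 0, 1])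
    (g : SL(2, ℤ)) : g * ModularGroup.T ^ (wohlfahrtLevel H * p) * g⁻¹ ∈ conjGL H A :=
  conj_T_pow_mul_mem_conjGL_of_forall_conj_T_pow_mem hp (conj_T_pow_wohlfahrtLevel_mem H) hA g

/-- **CDT Lemma 4.1.5** (arXiv v1: Lemma 21) verbatim, sign-free: "`L(A⁻¹ H A ∩ SL₂(ℤ))` divides
`N p`" where `N = L(H)`, for `p` prime and `A = diag(p, 1)` (given that `conjGL H A` has finite
index, which holds as `H` does — Mathlib `CongruenceSubgroup.finiteIndex_conjGL` for `H = ⊤`).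
[cite: CalegariDimitrovTang2025, Lemma 4.1.5] -/
theorem wohlfahrtLevel_conjGL_dvd {H : Subgroup SL(2, ℤ)} [H.FiniteIndex] {p : ℕ} (hp : p.Prime)
    {A : GL (Fin 2) ℝ} (hA : (A : Matrix (Fin 2) (Fin 2) ℝ) = !![(p : ℝ), 0; 0, 1])
    [(conjGL H A).FiniteIndex] : wohlfahrtLevel (conjGL H A) ∣ wohlfahrtLevel H * p :=
  (wohlfahrtLevel_dvd_iff _ _).mpr (conj_T_pow_wohlfahrtLevel_mul_mem_conjGL hp hA)

/-- For `H ≤ SL(2, ℤ)` of finite index and `g ∈ GL₂(ℚ)`, the subgroup `g⁻¹ H g ∩ SL(2, ℤ)`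
(`conjGL H g`) has finite index in `SL(2, ℤ)` (Mathlib: `H` is arithmetic, arithmeticity is
preserved by `GL₂(ℚ)`-conjugation, `Subgroup.IsArithmetic.conj`, and an arithmetic subgroup meets
`SL(2, ℤ)` with finite index, `Subgroup.IsArithmetic.finiteIndex_comap`; Mathlib states the case
`H = ⊤` as `CongruenceSubgroup.finiteIndex_conjGL`). [folklore] -/
theorem finiteIndex_conjGL_of_finiteIndex (H : Subgroup SL(2, ℤ)) [H.FiniteIndex]
    (g : GL (Fin 2) ℚ) : (conjGL H (g.map (Rat.castHom ℝ))).FiniteIndex := by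
  have h := Subgroup.IsArithmetic.conj (H : Subgroup (GL (Fin 2) ℝ)) g⁻¹
  rw [map_inv] at h
  exact Subgroup.IsArithmetic.finiteIndex_comap _

/-- **CDT Lemma 4.1.5** (arXiv v1: Lemma 21) verbatim and unconditionally, sign-free: for `p`
prime, `A = diag(p, 1) ∈ GL₂(ℚ)` and `H ≤ SL(2, ℤ)` of finite index,
`L(A⁻¹ H A ∩ SL₂(ℤ)) ∣ L(H) · p`. [cite: CalegariDimitrovTang2025, Lemma 4.1.5] -/
theorem wohlfahrtLevel_conjGL_map_dvd {H : Subgroup SL(2, ℤ)} [H.FiniteIndex] {p : ℕ}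
    (hp : p.Prime) {g : GL (Fin 2) ℚ}
    (hg : ((g.map (Rat.castHom ℝ) : GL (Fin 2) ℝ) : Matrix (Fin 2) (Fin 2) ℝ) =
      !![(p : ℝ), 0; 0, 1]) :
    wohlfahrtLevel (conjGL H (g.map (Rat.castHom ℝ))) ∣ wohlfahrtLevel H * p := by
  haveI := finiteIndex_conjGL_of_finiteIndex H g
  exact wohlfahrtLevel_conjGL_dvd hp hg

/-! ### §4.3, first paragraph — the form `f(pτ)`

[CalegariDimitrovTang2025, §4.3 of the published version, first paragraph]: "The main idea of this
section is to exploit the fact that `f(pτ) ∈ ℤ⟦q^{1/N}⟧` is also a modular form with integer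
coefficients for any prime `p`. Since the form `f(τ)` is invariant under `G`, the form `f(pτ)` is
invariant under `A⁻¹ G A` and thus also the group `A⁻¹ G A ∩ SL₂(ℤ)`. Now, by Lemma 4.1.5, we know
that this group has (Wohlfahrt) level dividing `2Np`. In particular `f(pτ)` has cusp width
dividing `2Np` at each cusp, and hence `f(pτ) ∈ R_{2Np}`." (`A = diag(p, 1)`, display (4.3);
arXiv v1, §4.3, runs the same argument with `f(τ/p)`.) For Mathlib's bundled holomorphic modular
forms of weight `k` on `Γ ≤ SL(2, ℤ)` this reads as follows (`A : GL (Fin 2) ℝ` any element with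
matrix `diag(p, 1)`, so that `A • τ = p τ`, `coe_diag_smul`):

* `exists_modularForm_conjGL_apply_diag_smul`: `τ ↦ f(pτ)` IS a weight-`k` modular form on
  `conjGL Γ A = A⁻¹ Γ A ∩ SL(2, ℤ)` — it is `p^{1-k} · (f ∣ₖ A)` (`slash_diag_apply`), Mathlib's
  `ModularForm.translate f A` on `A⁻¹ Γ A ≤ GL₂(ℝ)` restricted to its integral points;
* `mem_strictPeriods_conjGL_of_mem`: a strict period `h` of `Γ` (`[1 h; 0 1] ∈ Γ`) is one of
  `conjGL Γ A` (`A [1 h; 0 1] A⁻¹ = [1 h; 0 1]ᵖ`);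
* `qExpansion_coeff_of_apply_diag_smul`: at such a period the `q`-expansion of `f(pτ)` is that of
  `f` spread out by the factor `p` (`∑ aₘ q_h^{pm}`, `q_h = e^{2πiτ/h}`; uniqueness of
  `q`-expansions), so that any property of coefficients true at `0` — "rational integer",
  "algebraic integer" — passes from `f` to `f(pτ)` (`forall_coeff_qExpansion_of_apply_diag_smul`);
* `finiteIndex_conjGL_of_coe_eq_diag` and, with Lemma 4.1.5 (`wohlfahrtLevel_conjGL_dvd`), the
  assembled printed sentence `exists_modularForm_conjGL_of_forall_coeff_int`: `f(pτ)` is a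
  modular form with integer coefficients on the finite-index subgroup `A⁻¹ Γ A ∩ SL(2, ℤ)`, whose
  Wohlfahrt level divides `L(Γ) p`. -/

section diag

open scoped ModularForm Pointwise
open UpperHalfPlane

variable {p : ℕ} {A : GL (Fin 2) ℝ}

/-- Entries and determinant of an `A ∈ GL₂(ℝ)` with matrix `diag(p, 1)`; in particular `p ≠ 0`.
[folklore] -/
private lemma diag_entries (hA : (A : Matrix (Fin 2) (Fin 2) ℝ) = !![(p : ℝ), 0; 0, 1]) :
    (A : Matrix (Fin 2) (Fin 2) ℝ) 0 0 = p ∧ (A : Matrix (Fin 2) (Fin 2) ℝ) 0 1 = 0 ∧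
      (A : Matrix (Fin 2) (Fin 2) ℝ) 1 0 = 0 ∧ (A : Matrix (Fin 2) (Fin 2) ℝ) 1 1 = 1 ∧
      A.det.val = p ∧ 0 < p := by
  have hdet : A.det.val = p := by
    rw [Matrix.GeneralLinearGroup.val_det_apply, hA, Matrix.det_fin_two_of]; ring
  refine ⟨by rw [hA]; simp, by rw [hA]; simp, by rw [hA]; simp, by rw [hA]; simp, hdet, ?_⟩
  rcases Nat.eq_zero_or_pos p with h | h
  · exact absurd hdet (by rw [h, Nat.cast_zero]; exact A.det.ne_zero)
  · exact h

/-- An `A ∈ GL₂(ℝ)` with matrix `diag(p, 1)` acts on `ℍ` by `τ ↦ p τ`. [folklore] -/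
theorem coe_diag_smul (hA : (A : Matrix (Fin 2) (Fin 2) ℝ) = !![(p : ℝ), 0; 0, 1]) (τ : ℍ) :
    ((A • τ : ℍ) : ℂ) = (p : ℂ) * τ := by
  obtain ⟨h00, h01, h10, h11, hdet, hp⟩ := diag_entries hA
  have hdet' : 0 < A.det.val := by rw [hdet]; exact_mod_cast hp
  rw [coe_smul_of_det_pos hdet', num, denom]
  simp [h00, h01, h10, h11]

/-- `(f ∣ₖ A)(τ) = p^{k-1} f(pτ)` for `A` with matrix `diag(p, 1)`. [folklore] -/
theorem slash_diag_apply (hA : (A : Matrix (Fin 2) (Fin 2) ℝ) = !![(p : ℝ), 0; 0, 1])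
    (f : ℍ → ℂ) (k : ℤ) (τ : ℍ) :
    (f ∣[k] A) τ = (p : ℂ) ^ (k - 1) * f (A • τ) := by
  obtain ⟨h00, h01, h10, h11, hdet, hp⟩ := diag_entries hA
  have hdet' : 0 < A.det.val := by rw [hdet]; exact_mod_cast hp
  rw [ModularForm.slash_apply, σ, if_pos hdet', denom]
  simp [h10, h11, hdet, mul_comm]

/-- `A [1 h; 0 1] = [1 ph; 0 1] A` for `A` with matrix `diag(p, 1)`. [folklore] -/
private lemma diag_mul_upperRightHom (hA : (A : Matrix (Fin 2) (Fin 2) ℝ) = !![(p : ℝ), 0; 0, 1])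
    (h : ℝ) :
    A * Matrix.GeneralLinearGroup.upperRightHom h =
      Matrix.GeneralLinearGroup.upperRightHom ((p : ℝ) * h) * A := by
  apply Units.ext
  simp only [Units.val_mul, Matrix.GeneralLinearGroup.upperRightHom_apply, hA]
  ext i j
  fin_cases i <;> fin_cases j <;> simp [Matrix.mul_apply, Fin.sum_univ_two]

/-- A strict period `h` of `Γ ≤ SL(2, ℤ)` (`[1 h; 0 1] ∈ Γ`) is a strict period of
`conjGL Γ A = A⁻¹ Γ A ∩ SL(2, ℤ)` for `A` with matrix `diag(p, 1)`:
`A [1 h; 0 1] A⁻¹ = [1 ph; 0 1] = [1 h; 0 1]ᵖ ∈ Γ`. [folklore] -/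
theorem mem_strictPeriods_conjGL_of_mem (hA : (A : Matrix (Fin 2) (Fin 2) ℝ) = !![(p : ℝ), 0; 0, 1])
    {Γ : Subgroup SL(2, ℤ)} {h : ℝ} (hΓ : h ∈ (Γ : Subgroup (GL (Fin 2) ℝ)).strictPeriods) :
    h ∈ ((conjGL Γ A : Subgroup SL(2, ℤ)) : Subgroup (GL (Fin 2) ℝ)).strictPeriods := by
  rw [Subgroup.mem_strictPeriods_iff] at hΓ ⊢
  obtain ⟨γ, hγ, hγe⟩ := Subgroup.mem_map.mp hΓ
  refine Subgroup.mem_map.mpr ⟨γ, ?_, hγe⟩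
  rw [mem_conjGL]
  refine ⟨γ ^ p, pow_mem hγ p, ?_⟩
  rw [eq_mul_inv_iff_mul_eq]
  change mapGL ℝ (γ ^ p) * A = A * mapGL ℝ γ
  rw [map_pow, hγe, diag_mul_upperRightHom hA, ← AddChar.map_nsmul_eq_pow, nsmul_eq_mul]

/-- **`f(pτ)` is a modular form on `A⁻¹ Γ A ∩ SL(2, ℤ)`** (CDT §4.3: "Since the form `f(τ)` is
invariant under `G`, the form `f(pτ)` is invariant under `A⁻¹ G A` and thus also the group
`A⁻¹ G A ∩ SL₂(ℤ)`"): for a weight-`k` modular form `f` on `Γ ≤ SL(2, ℤ)` and `A ∈ GL₂(ℝ)` with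
matrix `diag(p, 1)`, the function `τ ↦ f(A • τ) = f(pτ)` is (the underlying function of) a
weight-`k` modular form on `conjGL Γ A` — namely `p^{1-k} · (f ∣ₖ A)`, Mathlib's translate of `f`
by `A` restricted from `A⁻¹ Γ A ≤ GL₂(ℝ)` to its integral points; holomorphy at the cusps is that
of the translate. [cite: CalegariDimitrovTang2025, §4.3 (published version), first paragraph] -/
theorem exists_modularForm_conjGL_apply_diag_smul {Γ : Subgroup SL(2, ℤ)} {k : ℤ}
    (f : ModularForm (Γ : Subgroup (GL (Fin 2) ℝ)) k)
    (hA : (A : Matrix (Fin 2) (Fin 2) ℝ) = !![(p : ℝ), 0; 0, 1]) :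
    ∃ g : ModularForm ((conjGL Γ A : Subgroup SL(2, ℤ)) : Subgroup (GL (Fin 2) ℝ)) k,
      ∀ τ, g τ = f (A • τ) := by
  obtain ⟨-, -, -, -, -, hp⟩ := diag_entries hA
  have hle : ((conjGL Γ A : Subgroup SL(2, ℤ)) : Subgroup (GL (Fin 2) ℝ)) ≤
      ConjAct.toConjAct A⁻¹ • (Γ : Subgroup (GL (Fin 2) ℝ)) := by
    rintro _ ⟨x, hx, rfl⟩
    exact hx
  -- the translate `f ∣ₖ A` restricted to `conjGL Γ A`, rescaled by the real constant `p^{1-k}`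
  let g₀ : ModularForm ((conjGL Γ A : Subgroup SL(2, ℤ)) : Subgroup (GL (Fin 2) ℝ)) k :=
    { toFun := ModularForm.translate f A
      slash_action_eq' := fun γ hγ ↦ (ModularForm.translate f A).slash_action_eq' γ (hle hγ)
      holo' := (ModularForm.translate f A).holo'
      bdd_at_cusps' := fun hc ↦ (ModularForm.translate f A).bdd_at_cusps' (hc.mono hle) }
  refine ⟨((p : ℝ) ^ (1 - k)) • g₀, fun τ ↦ ?_⟩
  have hp0 : (p : ℂ) ≠ 0 := by exact_mod_cast hp.ne'
  rw [ModularForm.smul_apply]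
  change ((p : ℝ) ^ (1 - k)) • (ModularForm.translate f A) τ = _
  rw [ModularForm.coe_translate, slash_diag_apply hA, Complex.real_smul, ← mul_assoc]
  push_cast
  rw [← zpow_add₀ hp0, show (1 - k) + (k - 1) = 0 by ring, zpow_zero, one_mul]

/-- `𝕢_h(pτ) = 𝕢_h(τ)ᵖ`. [folklore] -/
private lemma qParam_diag_smul (hA : (A : Matrix (Fin 2) (Fin 2) ℝ) = !![(p : ℝ), 0; 0, 1])
    (h : ℝ) (τ : ℍ) :
    Function.Periodic.qParam h ((A • τ : ℍ) : ℂ) = Function.Periodic.qParam h τ ^ p := by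
  simp only [Function.Periodic.qParam, ← Complex.exp_nat_mul, coe_diag_smul hA]
  congr 1
  ring

/-- **The `q`-expansion of `f(pτ)`.** If `g(τ) = f(A • τ) = f(pτ)` pointwise, `g` a modular form on
any `Γ' ≤ GL₂(ℝ)` and `f` one on `Γ`, and `h > 0` is a strict period of both groups, then the
`q`-expansion of `g` at the period `h` is that of `f` spread out by the factor `p`: its `n`-th
coefficient is the `(n/p)`-th coefficient of `f` if `p ∣ n` and `0` otherwise
(`f(pτ) = ∑ aₘ 𝕢_h(τ)^{pm}` and uniqueness of `q`-expansions). [folklore] -/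
theorem qExpansion_coeff_of_apply_diag_smul (hA : (A : Matrix (Fin 2) (Fin 2) ℝ) = !![(p : ℝ), 0; 0, 1])
    {Γ Γ' : Subgroup (GL (Fin 2) ℝ)} {k k' : ℤ} (f : ModularForm Γ k) (g : ModularForm Γ' k')
    (hg : ∀ τ, g τ = f (A • τ)) {h : ℝ} (hh : 0 < h) (hΓ : h ∈ Γ.strictPeriods)
    (hΓ' : h ∈ Γ'.strictPeriods) (n : ℕ) :
    PowerSeries.coeff n (qExpansion h g) =
      if p ∣ n then PowerSeries.coeff (n / p) (qExpansion h f) else 0 := by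
  classical
  obtain ⟨-, -, -, -, -, hp⟩ := diag_entries hA
  set c : ℕ → ℂ := fun j ↦ if p ∣ j then PowerSeries.coeff (j / p) (qExpansion h f) else 0
  suffices ∀ τ : ℍ, HasSum (fun j ↦ c j • Function.Periodic.qParam h τ ^ j) (g τ) from
    (ModularFormClass.qExpansion_coeff_unique hh hΓ' this n).symm
  haveI : Fact (IsCusp OnePoint.infty Γ) := ⟨Γ.isCusp_of_mem_strictPeriods hh hΓ⟩
  intro τ
  have hs := hasSum_qExpansion hh (SlashInvariantFormClass.periodic_comp_ofComplex f hΓ)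
    (ModularFormClass.holo f) (ModularFormClass.bdd_at_infty f) (A • τ)
  rw [hg τ]
  refine (Function.Injective.hasSum_iff (mul_right_injective₀ hp.ne') ?_).mp ?_
  · intro x hx
    have : ¬ p ∣ x := fun ⟨m, hm⟩ ↦ hx ⟨m, hm.symm⟩
    simp [c, this]
  · convert hs using 1
    funext m
    simp only [Function.comp_apply, c, dvd_mul_right, if_true, Nat.mul_div_cancel_left _ hp,
      pow_mul, qParam_diag_smul hA h τ]

/-- Consequently any property of `q`-expansion coefficients true at `0` ("is a rational integer",
"is an algebraic integer", …) passes from `f` to `f(pτ)`: CDT's "`f(pτ) ∈ ℤ⟦q^{1/N}⟧` is also a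
modular form with integer coefficients". [cite: CalegariDimitrovTang2025, §4.3 (published
version), first paragraph] -/
theorem forall_coeff_qExpansion_of_apply_diag_smul
    (hA : (A : Matrix (Fin 2) (Fin 2) ℝ) = !![(p : ℝ), 0; 0, 1])
    {Γ Γ' : Subgroup (GL (Fin 2) ℝ)} {k k' : ℤ} (f : ModularForm Γ k) (g : ModularForm Γ' k')
    (hg : ∀ τ, g τ = f (A • τ)) {h : ℝ} (hh : 0 < h) (hΓ : h ∈ Γ.strictPeriods)
    (hΓ' : h ∈ Γ'.strictPeriods) {P : ℂ → Prop} (h0 : P 0)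
    (hf : ∀ n, P (PowerSeries.coeff n (qExpansion h f))) (n : ℕ) :
    P (PowerSeries.coeff n (qExpansion h g)) := by
  rw [qExpansion_coeff_of_apply_diag_smul hA f g hg hh hΓ hΓ' n]
  split_ifs
  · exact hf _
  · exact h0

/-- For `Γ ≤ SL(2, ℤ)` of finite index and `A ∈ GL₂(ℝ)` with matrix `diag(p, 1)`, the subgroup
`conjGL Γ A = A⁻¹ Γ A ∩ SL(2, ℤ)` has finite index (`A` comes from `GL₂(ℚ)`;
`finiteIndex_conjGL_of_finiteIndex`). [folklore] -/
theorem finiteIndex_conjGL_of_coe_eq_diag (Γ : Subgroup SL(2, ℤ)) [Γ.FiniteIndex]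
    (hA : (A : Matrix (Fin 2) (Fin 2) ℝ) = !![(p : ℝ), 0; 0, 1]) : (conjGL Γ A).FiniteIndex := by
  obtain ⟨-, -, -, -, -, hp⟩ := diag_entries hA
  let g : GL (Fin 2) ℚ := Matrix.GeneralLinearGroup.mkOfDetNeZero !![(p : ℚ), 0; 0, 1]
    (by rw [Matrix.det_fin_two_of]; simp [hp.ne'])
  have hg : g.map (Rat.castHom ℝ) = A := by
    apply Units.ext
    rw [hA]
    ext i j
    fin_cases i <;> fin_cases j <;> simp [g, Matrix.GeneralLinearGroup.mkOfDetNeZero]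
  rw [← hg]
  exact finiteIndex_conjGL_of_finiteIndex Γ g

/-- **CDT §4.3, first paragraph, assembled** [cite: CalegariDimitrovTang2025, §4.3 (published
version), first paragraph; Lemma 4.1.5]: let `f` be a weight-`k` modular form on a finite-index
`Γ ≤ SL(2, ℤ)` whose `q`-expansion at a positive integral strict period `h` has rational-integer
coefficients, `p` a prime and `A ∈ GL₂(ℝ)` with matrix `diag(p, 1)`. Then
`A⁻¹ Γ A ∩ SL(2, ℤ) = conjGL Γ A` has finite index and Wohlfahrt level dividing `L(Γ) p`, `h` is
one of its strict periods, and `f(pτ)` is a weight-`k` modular form on it whose `q`-expansion at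
`h` has rational-integer coefficients ("`f(pτ) ∈ ℤ⟦q^{1/N}⟧` is also a modular form with integer
coefficients … invariant under `A⁻¹ G A ∩ SL₂(ℤ)` … (Wohlfahrt) level dividing `2Np` … hence
`f(pτ) ∈ R_{2Np}`", in Mathlib's holomorphic weight-`k` setting). -/
theorem exists_modularForm_conjGL_of_forall_coeff_int {Γ : Subgroup SL(2, ℤ)} [Γ.FiniteIndex]
    {k : ℤ} (f : ModularForm (Γ : Subgroup (GL (Fin 2) ℝ)) k) {p : ℕ} (hp : p.Prime)
    {A : GL (Fin 2) ℝ} (hA : (A : Matrix (Fin 2) (Fin 2) ℝ) = !![(p : ℝ), 0; 0, 1])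
    {h : ℕ} (hh : 0 < h) (hΓ : (h : ℝ) ∈ (Γ : Subgroup (GL (Fin 2) ℝ)).strictPeriods)
    (hint : ∀ n, ∃ z : ℤ, PowerSeries.coeff n (qExpansion (h : ℝ) f) = z) :
    (conjGL Γ A).FiniteIndex ∧ wohlfahrtLevel (conjGL Γ A) ∣ wohlfahrtLevel Γ * p ∧
      (h : ℝ) ∈ ((conjGL Γ A : Subgroup SL(2, ℤ)) : Subgroup (GL (Fin 2) ℝ)).strictPeriods ∧
      ∃ g : ModularForm ((conjGL Γ A : Subgroup SL(2, ℤ)) : Subgroup (GL (Fin 2) ℝ)) k,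
        (∀ τ, g τ = f (A • τ)) ∧ ∀ n, ∃ z : ℤ, PowerSeries.coeff n (qExpansion (h : ℝ) g) = z := by
  haveI := finiteIndex_conjGL_of_coe_eq_diag Γ hA
  have hΓ' := mem_strictPeriods_conjGL_of_mem hA hΓ
  obtain ⟨g, hg⟩ := exists_modularForm_conjGL_apply_diag_smul f hA
  exact ⟨inferInstance, wohlfahrtLevel_conjGL_dvd hp hA, hΓ', g, hg,
    forall_coeff_qExpansion_of_apply_diag_smul hA f g hg (Nat.cast_pos.mpr hh) hΓ hΓ'
      (P := fun x ↦ ∃ z : ℤ, x = z) ⟨0, by simp⟩ hint⟩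

end diag

/-! ### §3 — the arithmetic of the proof of Proposition 3.0.1 (displays (3.3)–(3.5))

CDT Proposition 3.0.1 (published numbering; arXiv v1 Proposition 15) reduces the unbounded
denominators conjecture to (radius) a lower bound `|F_N'(0)| ≥ 16^{1/N}(1 + A/N³)` for the
conformal radius of the universal covering map `F_N : D(0,1) → ℂ ∖ μ_N` and (mean) a bound
`∫_{|z| = 1 − B N⁻³} log⁺|F_N| ≪ (log N)/N`, via the holonomy bound of Corollary 2.0.3 applied to
`φ(z) = 16^{-1/N} F_N(r z)`, `r = 1 − A N⁻³/2`, `p(x) = xᴺ`: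
`dim ≤ e · ∫_{|z|=1} log⁺|φᴺ| / log|φ'(0)|` with `log|φ'(0)| > log(1 + A/N³) + log r > c N⁻³`
(displays (3.3)–(3.4)) and `∫_{|z|=1} log⁺|φᴺ| ≤ N ∫_{|z|=r} log⁺|F_N| ≪ log N` (display (3.5) and
after). The following records this bookkeeping with explicit constants, the three analytic inputs
(holonomy bound, radius bound, mean growth bound) being hypotheses on real parameters. -/

/-- `log(1 + u) + log(1 − u/2) ≥ u/4` for `0 ≤ u ≤ 2/9` (the estimate behind CDT (3.3)–(3.4):
`log|φ'(0)| > log(1 + A/N³) + log(1 − A/(2N³)) ≥ c/N³`). [folklore] -/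
theorem CalegariDimitrovTang2025_unboundedDenominators.log_one_add_add_log_one_sub_half_ge
    {u : ℝ} (hu0 : 0 ≤ u) (hu : u ≤ 2 / 9) :
    u / 4 ≤ Real.log (1 + u) + Real.log (1 - u / 2) := by
  have h1 : 0 < 1 + u := by linarith
  have h2 : 0 < 1 - u / 2 := by linarith
  -- `log x ≥ 1 − 1/x`, i.e. `log (1/x) ≤ 1/x − 1`
  have hl1 : u / (1 + u) ≤ Real.log (1 + u) := by
    have := Real.log_le_sub_one_of_pos (inv_pos.mpr h1)
    rw [Real.log_inv] at this
    have hid : (1 + u)⁻¹ - 1 = -(u / (1 + u)) := by field_simp; ring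
    linarith [hid]
  have hl2 : -((u / 2) / (1 - u / 2)) ≤ Real.log (1 - u / 2) := by
    have := Real.log_le_sub_one_of_pos (inv_pos.mpr h2)
    rw [Real.log_inv] at this
    have hid : (1 - u / 2)⁻¹ - 1 = (u / 2) / (1 - u / 2) := by
      rw [inv_eq_one_div, div_sub_one h2.ne']
      congr 1
      ring
    linarith [hid]
  -- `u/(1+u) − (u/2)/(1 − u/2) ≥ u/4` on `[0, 2/9]`
  have hA : 9 * u / 11 ≤ u / (1 + u) := by
    rw [div_le_div_iff₀ (by norm_num) h1]; nlinarith
  have hB : (u / 2) / (1 - u / 2) ≤ 9 * u / 16 := by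
    rw [div_le_div_iff₀ h2 (by norm_num)]; nlinarith
  linarith

/-- **The arithmetic of CDT Proposition 3.0.1** [cite: CalegariDimitrovTang2025, proof of
Proposition 3.0.1, displays (3.3)–(3.5)]. Let `A > 0`, `K ≥ 0`, `N ≥ 1` with `A/N³ ≤ 2/9`
("`N ≫ 1` sufficiently large"). Suppose the conformal radius `ρ = |F_N'(0)|` satisfies
`ρ ≥ 16^{1/N}(1 + A/N³)` (hypothesis (radius)), the mean proximity `I = ∫_{|z|=r} log⁺|F_N|`,
`r = 1 − A/(2N³)`, satisfies `I ≤ K (log N)/N` (hypothesis (mean) with `B = A/2`), and the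
dimension `D` obeys the holonomy bound of Corollary 2.0.3 for `φ(z) = 16^{-1/N} F_N(rz)`,
`p(x) = xᴺ`, in the form `D ≤ e · (N I) / log|φ'(0)|` with `|φ'(0)| = 16^{-1/N} r ρ` (using
`∫_{|z|=1} log⁺|φᴺ| = N ∫_{|z|=1} log⁺|φ| ≤ N I`). Then `D ≤ (4e K/A) · N³ log N`. -/
theorem CalegariDimitrovTang2025_unboundedDenominators.dim_le_of_radius_of_mean
    {A K : ℝ} (hA : 0 < A) {N : ℕ} (hN : 1 ≤ N) (hAN : A / (N : ℝ) ^ 3 ≤ 2 / 9)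
    {D ρ I : ℝ} (hrad : (16 : ℝ) ^ ((N : ℝ)⁻¹) * (1 + A / (N : ℝ) ^ 3) ≤ ρ)
    (hmean : I ≤ K * Real.log N / N) (hI : 0 ≤ I)
    (hhol : D ≤ Real.exp 1 * (N * I) /
      Real.log ((16 : ℝ) ^ (-(N : ℝ)⁻¹) * (1 - A / (2 * (N : ℝ) ^ 3)) * ρ)) :
    D ≤ 4 * Real.exp 1 * K / A * (N : ℝ) ^ 3 * Real.log N := by
  have hNpos : (0 : ℝ) < N := by exact_mod_cast hN
  have hN3 : (0 : ℝ) < (N : ℝ) ^ 3 := by positivity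
  set u := A / (N : ℝ) ^ 3 with hu
  have hu0 : 0 < u := by positivity
  have h16 : (0 : ℝ) < (16 : ℝ) ^ ((N : ℝ)⁻¹) := by positivity
  have h16' : (16 : ℝ) ^ (-(N : ℝ)⁻¹) * (16 : ℝ) ^ ((N : ℝ)⁻¹) = 1 := by
    rw [← Real.rpow_add (by norm_num), neg_add_cancel, Real.rpow_zero]
  -- `16^{-1/N} ρ ≥ 1 + u`
  have hρ : 1 + u ≤ (16 : ℝ) ^ (-(N : ℝ)⁻¹) * ρ := by
    have := mul_le_mul_of_nonneg_left hrad (le_of_lt (by positivity : (0 : ℝ) < (16 : ℝ) ^ (-(N : ℝ)⁻¹)))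
    rwa [← mul_assoc, h16', one_mul] at this
  -- the log of the conformal radius of `φ`
  set L := Real.log ((16 : ℝ) ^ (-(N : ℝ)⁻¹) * (1 - A / (2 * (N : ℝ) ^ 3)) * ρ) with hL
  have hr : 0 < 1 - u / 2 := by rw [hu]; linarith
  have hAu : A / (2 * (N : ℝ) ^ 3) = u / 2 := by rw [hu]; ring
  have hLge : u / 4 ≤ L := by
    have h1 : Real.log (1 + u) + Real.log (1 - u / 2) ≤ L := by
      rw [hL, hAu, ← Real.log_mul (by linarith) hr.ne']
      refine Real.log_le_log (mul_pos (by linarith) hr) ?_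
      calc (1 + u) * (1 - u / 2) = (1 - u / 2) * (1 + u) := by ring
        _ ≤ (1 - u / 2) * ((16 : ℝ) ^ (-(N : ℝ)⁻¹) * ρ) := mul_le_mul_of_nonneg_left hρ hr.le
        _ = (16 : ℝ) ^ (-(N : ℝ)⁻¹) * (1 - u / 2) * ρ := by ring
    linarith [CalegariDimitrovTang2025_unboundedDenominators.log_one_add_add_log_one_sub_half_ge
      hu0.le hAN]
  have hLpos : 0 < L := lt_of_lt_of_le (by positivity) hLge
  -- `N I ≤ K log N`
  have hNI : (N : ℝ) * I ≤ K * Real.log N := by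
    have := mul_le_mul_of_nonneg_left hmean hNpos.le
    rwa [mul_div_assoc', mul_comm (N : ℝ) (K * Real.log N), mul_div_assoc, div_self hNpos.ne',
      mul_one] at this
  have hlogN : 0 ≤ Real.log N := Real.log_nonneg (by exact_mod_cast hN)
  have hNI0 : 0 ≤ (N : ℝ) * I := by positivity
  -- assemble
  calc D ≤ Real.exp 1 * (N * I) / L := hhol
    _ ≤ Real.exp 1 * (N * I) / (u / 4) := by
        apply div_le_div_of_nonneg_left (by positivity) (by positivity) hLge
    _ ≤ Real.exp 1 * (K * Real.log N) / (u / 4) := by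
        gcongr
    _ = 4 * Real.exp 1 * K / A * (N : ℝ) ^ 3 * Real.log N := by
        rw [hu]
        field_simp


/-! ## Map: the formalized pieces of Calegari–Dimitrov–Tang's proof (published numbering)

For orientation across the tree (all sorry-free; `p…` are gate proposal ids):

| CDT item | Lean | file |
|---|---|---|
| Thm 1.0.1 (the statement) | `CalegariDimitrovTang2025_unboundedDenominators[_algInt]` (named facts) | `UnboundedDenominators.lean` |
| weights `k ≤ 0`, congruence `Γ`, reduction to `k ≥ 1` | `….of_weight_nonpos`, `….of_pos_weight_case` | `UnboundedDenominators.lean` |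
| outer reductions (period change, twists, core case) | `….of_core_twelve_mul_and_odd` &c. | `UnboundedDenominatorsReductions.lean` |
| conclusion as `Γ(N)`-invariance | `exists_congruence_modularForm_coe_eq_iff` | `UnboundedDenominatorsGammaInvariance.lean` |
| Lemma 1.2.2 (Diophantine principle) | `….eventually_eq_zero_of_summable[_on_disc]` | this file |
| §2.1 `(1+u)^{1/N} ∈ ℤ⟦u/N²⟧` | `Literature.RingTheory.Binomial.isInt_pow_mul_choose_inv` | `RingTheory/Binomial/BinomialSeriesRootDenominators.lean` |
| §2.1 `t(x)`, `f(x) ∈ ℤ⟦x/M⟧` | `Literature.RingTheory.PowerSeries.rescale_mem_range_of_subst_mem_range` | `RingTheory/PowerSeries/DenominatorTypeInversion.lean` |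
| §2.1 `x ∈ t + (t²/M)ℤ⟦t/M⟧` from `x^N ∈ ℤ⟦t⟧` (`p = x^N`, `M = N²`) | `Literature.RingTheory.PowerSeries.exists_denominatorType_of_pow_eq_map` | `RingTheory/PowerSeries/NthRootDenominatorType.lean` |
| §2.1 (2.3): `f_i` convergent on `|x| < ρ` | `Literature.Analysis.Complex.exists_norm_coeff_le_of_subst_eq` | `Analysis/Complex/PullbackConvergence.lean` |
| §2.1 equation count `C(α+d−1,d)`; Siegel's lemma with Dirichlet exponent `κ` | `Literature.Combinatorics.Enumerative.card_sigma_range_antidiagonalTuple`; `Literature.NumberTheory.DiophantineApproximation.exists_ne_zero_int_vec_log_norm_le` | `Combinatorics/Enumerative/AntidiagonalTupleCard.lean`; `NumberTheory/DiophantineApproximation/SiegelLemmaMargin.lean` |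
| §2.1 independence of the `∏_s f_{i_s}(x_s)` over `ℚ(p(x_s))_s` | `Literature.RingTheory.MvPowerSeries.productFamily_independent_fin` | `RingTheory/MvPowerSeries/ProductFamilyIndependence.lean` |
| Lemma 2.1.1 (auxiliary construction: arithmetic core, `F ≢ 0`, degree parameter (1)) | `Literature.NumberTheory.DiophantineApproximation.exists_auxiliary_coefficients`, `….sum_smul_prod_ne_zero`; `Literature.Analysis.Asymptotics.exists_degree_param` | `NumberTheory/DiophantineApproximation/SeparatedVariablesAuxiliary.lean`; `Analysis/Asymptotics/HolonomyBoundLimits.lean` |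
| §2.2 Liouville lower bound (2.6) | `Literature.RingTheory.MvPowerSeries.one_le_abs_coeff_of_ne_zero` | `RingTheory/MvPowerSeries/LowestOrderIntegrality.lean` |
| §2.2 (2.4)–(2.7) with the term estimate (`p = x^N`) | `Literature.Analysis.Complex.norm_deriv_pow_mul_coeff_le` | `Analysis/Complex/AuxiliaryCauchyUpperBound.lean` |
| Lemma 2.0.4 and Theorem 2.0.1 (2.2) for `p(x) = x^N` | `Literature.NumberTheory.DiophantineApproximation.dim_le_of_multiplier_pow`, `….dim_le_circleAverage_posLog_pow` | `NumberTheory/DiophantineApproximation/ArithmeticHolonomyBound.lean` |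
| §2.2 lowest-order monomials (2.6)–(2.7) | `Literature.RingTheory.MvPowerSeries.coeff_subst_of_degree_eq` | `RingTheory/MvPowerSeries/LeadingFormSubst.lean` |
| §2.2 Cauchy upper bound (2.7) | `Literature.Analysis.Complex.norm_sum_prod_taylorCoeff_le` | `Analysis/Complex/DecomposableCauchyBound.lean` |
| §2.2 Stirling limit | `Literature.Analysis.SpecialFunctions.tendsto_div_factorial_rpow_mul_rpow` | `Analysis/SpecialFunctions/FactorialRootLimit.lean` |
| §2.2 limits `α → ∞`, `d → ∞`, `κ → 0` | `Literature.Analysis.Asymptotics.le_exp_mul_div_of_forall_dim_bound` | `Analysis/Asymptotics/HolonomyBoundLimits.lean` |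
| Lemma 2.3.1 (Nevanlinna), §2.3 glue, Remark 2.3.2 | `exists_holomorphic_multiplier`, `le_of_forall_multiplier_bound`, `circleAverage_posLog_norm_le_of_multiplier` | `Analysis/Complex/NevanlinnaMultiplier.lean` |
| Prop 3.0.1, displays (3.3)–(3.5) | `….dim_le_of_radius_of_mean` | this file |
| Def 4.1.1 (Wohlfahrt level) | `cuspWidth`, `wohlfahrtLevel` | `WohlfahrtLevel.lean` |
| Wohlfahrt's theorem; Lemmas 4.1.2, 4.1.3, 4.1.5 | `Gamma_wohlfahrtLevel_le_of_isCongruenceSubgroup`, `wohlfahrtLevel_inf_dvd`, `wohlfahrtLevel_normalCore`, `wohlfahrtLevel_conjGL_map_dvd` | this file (and `WohlfahrtTheorem.lean`) |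
| §4.3 ¶1 (`f(pτ)`), Prop 4.3.3 skeleton | `exists_modularForm_conjGL_of_forall_coeff_int`, `….le_one_of_log_bound_of_doubling` | this file |
| Lemma 6.1.2 (log-derivative lemma) | `Literature.Analysis.Complex.circleAverage_posLog_norm_logDeriv_lt` | `Analysis/Complex/LogDerivativeLemma.lean` |
| Cor 6.2.1, Cor 6.2.2, (6.12) (Thm 6.0.1 modulo Lemma 5.3.5) | `cor621`, `cor622`, `uniform_growth_of_omitting_rootsOfUnity` | `Analysis/Complex/OmittedValuesGrowth.lean` |

Not formalized (no Mathlib base yet): Theorem 2.0.1 for a general rational function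
`p ∈ ℚ(x)` (Eisenstein's theorem on denominators of algebraic power series) and its algebraicity
conclusion; Corollaries 2.0.2–2.0.3 (holonomic functions, local monodromy of linear ODEs); the
algebro-geometric reductions of Proposition 3.0.1; Theorems 4.3.1–4.3.2 and §§4.4–4.6 (amalgams,
congruence subgroup property, cohomology of `SL₂(ℤ̂)`, Ihara's lemma); §5 (uniformization of
`ℂ ∖ μ_N`, conformal radius, Lemma 5.3.5); the final assembly of §6.3. -/

end Literature.NumberTheory.Automorphic
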